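import Literature.MathematicalPhysics.QuantumFieldTheory.Balaban1983to89.B8Ineq130

/-!
# `Balaban1983to89.B8Ineq165Descent` — T. Bałaban, *Spaces of regular gauge field configurations on a lattice and
# gauge fixing conditions*, Commun. Math. Phys. **99** (1985) 75–102 [Balaban1985RegularSpaces] ("B8"), p. 87,
# the inequality **(1.65)**: the iterated-Lemma-1 DESCENT WITH A GENERAL BACKGROUND `U₀` — *"Thus the conditions
# (1.33)–(1.35) imply |(\overline{U′U₀})ʲ − Ū₀ʲ| = |Ũ′ʲ − 1| < 8d²α₀/(1 − L⁻²) + α₁ < 11d²α₀ + α₁ on Ω_j^{(j)}"* —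
# kernel-proved on the `ℤ^d` carriers of the tree

statement-level skeleton of published theorems with citation tags; proofs where landed; nothing here is a claim about the Yang–Mills mass gap

PDF held: `paper:balaban1985-cmp99-regular-spaces-gauge-fixing` (journal page = PDF page + 74; p. 87 = PDF p. 13,
pp. 77–79 = PDF pp. 3–5, p. 82 = PDF p. 8; text layer re-read for this file, displays checked against the quotations
in the module docstrings of `B8Ineq130` / `B8Lemma1NonAbelian` / `B8Prop6OfThm4`, which were read off the page
renders).

WHAT IS REPRODUCED (mega-formalization `lit-balaban`, HOME `run/shared/lean/pub/lit-balaban/`, Phase-2 seat p26,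
generation 6; SKELETON row **B8.Eq1.65** (reader r05, referee ref-4), whose cell records that the tree's kernel proof
of the descent — `B8Ineq130.descent` — is the special case `U₀ = 1` ("one step = Lemma 1 with `V₀ = 1`"); this file
is the general case, i.e. the printed (1.65) itself; it is also the input *"(1.65) [14]"* of [Balaban1989LargeFieldI]
p. 197 (1.84), row B15.Eq1.84, served in the sibling file `B15Ineq184BlockAxial`).

THE PRINTED TEXT (p. 87 [PDF 13], verbatim up to OCR): *"We will prove Theorem 2 by induction. To use the inductive
assumptions easily we have to reformulate the conditions (1.35). … By Proposition 2 of [3] the bounds |∂U − 1| < α₀η²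
imply |∂Ūʲ − 1| < α₀(Lʲη)² + 2C₁(α₀(Lʲη)²)² < 2α₀(Lʲη)², j = 0, 1, …, k for α₀ small. Let us take j = k − 1 and let
us apply Lemma 1 to V₀ = Ū₀^{k−1}, V′V₀ = (\overline{U′U₀})^{k−1} = Ũ′^{k−1}Ū₀^{k−1}. Of course all the assumptions
are satisfied and we obtain |V′ − 1| = |Ũ′^{k−1} − 1| < 8d²α₀ + α₁. We apply again the Lemma 1 to V₀ = Ū₀^{k−2},
V′V₀ = Ũ′^{k−2}Ū₀^{k−2} and the constant α₁ replaced by 8d²α₀ + α₁, and we obtain |Ũ′^{k−2} − 1| < 8d²α₀L⁻² + 8d²α₀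
+ α₁. Continuing these arguments we get |Ũ′ʲ − 1| < 8d²α₀L^{−2(k−j−1)} + … + 8d²α₀L⁻² + 8d²α₀ + α₁ < 8d²α₀ ·
1/(1 − L⁻²) + α₁ < 11d²α₀ + α₁. Thus the conditions (1.33)–(1.35) imply  |(\overline{U′U₀})ʲ − Ū₀ʲ| = |Ũ′ʲ − 1| <
11d²α₀ + α₁ on Ω_j^{(j)}. (1.65)"*.  The hypotheses (p. 82 [PDF 8]): *"U₀ ∈ 𝔄_k({Ω_j}, α₀) … (1.33);  U′U₀ ∈
𝔄_k({Ω_j}, α₀) ∩ Ax_k(𝔅_k, U₀), (1.34);  |(\overline{U′U₀})ʲ − Ū₀ʲ| < α₁ on Λ_j, j = 0, 1, …, k. (1.35)"*; the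
axial gauge relative to `U₀` (p. 79 (1.19)): *"(R̄ⁿ_{0,x_{n+1}}Ũ′ⁿ)(Γ_{x_{n+1},x_n}) = ∏_{b⊂Γ_{x_{n+1},x_n}}
R(Ū₀ⁿ(Γ_{x_{n+1},b₋}))Ũ′ⁿ_b = 1"* with *"Ũ′ⁿ = (\overline{U′U₀})ⁿ(Ū₀ⁿ)⁻¹. (1.20)"*; Lemma 1 (p. 79): *"Let V₀,
V′V₀ satisfy the condition (1.7) for k = 1 and L arbitrary, and let (R(V₀)V′)(Γ_{y,x}) = 1 for x ∈ B(y),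
|\overline{V′V₀} − V̄₀| < α₁ on Ω₁^{(1)}. (1.24) Then … |V′ − 1| < 4d²α₀ + α₁ on Ω₁. (1.25)"*.

THE PROOF (the printed one).  `§1` the printed identity `|(\overline{U′U₀})ʲ − Ū₀ʲ| = |Ũ′ʲ − 1|` for unit-norm
values; `§2` THE DESCENT `descent_bg`: abstract over a tower of cubes `□̃^{(j)} = [tlo n, thi n]`, `n = k − j` (the
geometry of `B8Ineq130`), for a fine field `U` (= `U′U₀`) and a BACKGROUND TOWER `Bg n` on the depth-`n` lattice
that is consistent under the average (42) of [3] (`\overline{Bg (n+1)} = Bg n`; for (1.65) `Bg n = Ū₀^{k−n}`): top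
closeness `α₁` ((1.35) at level `k`) + plaquette bounds `a_n` per level + (1.19) between consecutive levels ⟹
`|Ū^{k−n}_b − (Bg n)_b| ≤ α₁ + Σ_{m<n} 4d²L²a_{m+1}`; one step = Lemma 1 WITH ITS BACKGROUND on each pair of adjacent
blocks (`B8Lemma1NonAbelian.lemma1_printedBound`, V₀ = `Bg (n+1)`) or its interior half on one block
(`B8Lemma1NonAbelian.interior_bound`) — literally the tree's `B8Ineq130.descent` with `1` replaced by `Bg`; `§3`
the printed (1.65) in the global `ℤ^d` model: (1.33)/(1.34) regularity delivered by Proposition 2 of [3]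
(`B8Ineq130.ineq128_global`: `|∂Ūʲ − 1|, |∂Ū₀ʲ − 1| < 2α₀(Lʲη)²`), the descent sum `8d²α₀(L^{−2(n−1)} + … + 1)`
and its bounds `≤ 8d²α₀ · 4/3 < 11d²α₀` (`B8Ineq130.geom_sum_le`; the tree's constant lemma `B8.ineq165`).

DICTIONARY (as in `B8Ineq130`, header there): every level `Ω^{(j)}` is `ℤ^d`, the level below is its `L`-fold
refinement, `η = L^{−k}`, level `j` ↦ depth `n = k − j`, `Ūʲ = avgIter L U j` ((43) of [3]); `□̃^{(j)}` ↦
`[tlo L lo n, thi L hi n]`; (1.19)/(1.24) for the pair `Ūⁿ, Ū₀ⁿ` in the transporter form `Ūⁿ(Γ_{Lz,x}) =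
Ū₀ⁿ(Γ_{Lz,x})`, `x ∈ B(Lz)` (`B8Lemma1NonAbelian.covProd_eq_one_iff`: `(R(V₀)V′)(Γ) = 1 ↔ (V′V₀)(Γ) = V₀(Γ)`),
i.e. `axialFn (avgIter L U (k−(n+1))) (L•z) (L•z + r) = axialFn (avgIter L U₀ (k−(n+1))) (L•z) (L•z + r)`; (1.7) at
the top level in η-units, *"|∂U − 1| < α₀η²"*, ↦ `pdev U < α₀(L^{−k})²` (global sup form of `B7Prop2Explicit`);
"α₀ small" ↦ Prop. 1/2 smallness of [3] (`C₀α₀ ≤ ⅓`, `2α₀ ≤ c₂′`) and Lemma 1's (`11d²α₀ + α₁ ≤ 1/6`).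

HONEST SCOPE / DEVIATIONS.  (1) The printed BACKGROUND plaquette hypothesis enters Lemma 1 only on the two-block
regions `B(c₋) ∪ B(c₊)` (`Hyp.plaqV₀`); `descent_bg` asks exactly that (`hplaqBg`), which is what makes the B15 use
(background = pull-backs `Q^{s*}V_Λ`, whose plaquettes are `1` on every block pair) legitimate; for (1.65) proper it
is implied by (1.33) + Prop. 2.  (2) (1.35) is used at the top level `j = k` only and the conclusion is on the tower
of cubes below the top cube (the torus bookkeeping `Λ_j`, `𝔅_k`, (1.12)–(1.14) is replaced by the cubes, as in
`B8Ineq130`, HONEST SCOPE (vi) there); on `Λ_j`, `j < k`, (1.65) is (1.35) itself.  (3) `≤` for the first printed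
`<` (the inputs are `≤`-hypotheses), the members `< 11d²α₀ + α₁` strict as printed (`32/3 < 11`).  (4) Values in an
`AvgClosed` subgroup `G ≤ U1 𝔸` of a complete normed `ℂ`-algebra (`U(N)`, `SU(N)`: `B7Prop2Explicit`,
`B7Prop2SpecialUnitary`), as in all `ℤ^d`-carrier files.  (5) The EXISTENCE of the gauge `Ax_k(𝔅_k, U₀)` (p. 79
"The conditions (1.19) determine uniquely an element in each orbit") is not used or asserted: (1.19) is a hypothesis
on the pair `U, U₀`, as (1.34) is in print.  Every declaration is a proved theorem; no `def`, no new `Prop` fact.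
Unit `lit-balaban-p26` (literature-prover-lit-balaban-p26-g6-0).
-/

noncomputable section

open scoped BigOperators
open Finset

namespace Literature.MathematicalPhysics.QuantumFieldTheory.Balaban1983to89.B8Ineq165Descent

open B7Prop1Explicit B7Prop2Explicit B8Lemma1NonAbelian B8Ineq129 B8Ineq130

-- `Site` alone would resolve to the torus sites of `Setup.lean`; re-export the `ℤ^d` sites of `B7Prop1Explicit`.
export B7Prop1Explicit (Site)

variable {d : ℕ}

/-! ## §1 *"|(\overline{U′U₀})ʲ − Ū₀ʲ| = |Ũ′ʲ − 1|"* — the two norms agree for unit-norm values -/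

section Norms

variable {𝔸 : Type*} [NormedRing 𝔸] [NormOneClass 𝔸]

/-- `‖p − q‖ ≤ ‖pq⁻¹ − 1‖` for `‖q‖ ≤ 1` (`p − q = (pq⁻¹ − 1)q`): the difference is controlled by the perturbation
(1.20) `Ũ′ = \overline{U′U₀}·(Ū₀)⁻¹`. [cite: Balaban1985RegularSpaces, (1.20) p.79, (1.65) p.87] -/
theorem norm_sub_le_norm_pert {p q : 𝔸ˣ} (hq : q ∈ U1 𝔸) :
    ‖(p : 𝔸) - q‖ ≤ ‖((p * q⁻¹ : 𝔸ˣ) : 𝔸) - 1‖ := by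
  have h : (p : 𝔸) - q = (((p * q⁻¹ : 𝔸ˣ) : 𝔸) - 1) * (q : 𝔸) := by
    rw [sub_mul, one_mul, ← Units.val_mul, inv_mul_cancel_right]
  rw [h]
  refine (norm_mul_le _ _).trans ?_
  have hq1 := (mem_U1.mp hq).1
  have h0 : 0 ≤ ‖((p * q⁻¹ : 𝔸ˣ) : 𝔸) - 1‖ := norm_nonneg _
  nlinarith

/-- `‖pq⁻¹ − 1‖ ≤ ‖p − q‖` for `‖q⁻¹‖ ≤ 1` (`pq⁻¹ − 1 = (p − q)q⁻¹`). [cite: Balaban1985RegularSpaces, (1.20) p.79, (1.65) p.87] -/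
theorem norm_pert_le_norm_sub {p q : 𝔸ˣ} (hq : q ∈ U1 𝔸) :
    ‖((p * q⁻¹ : 𝔸ˣ) : 𝔸) - 1‖ ≤ ‖(p : 𝔸) - q‖ := by
  have h : ((p * q⁻¹ : 𝔸ˣ) : 𝔸) - 1 = ((p : 𝔸) - q) * ((q⁻¹ : 𝔸ˣ) : 𝔸) := by
    rw [sub_mul, Units.mul_inv, Units.val_mul]
  rw [h]
  refine (norm_mul_le _ _).trans ?_
  have hq1 := (mem_U1.mp hq).2
  have h0 : 0 ≤ ‖(p : 𝔸) - q‖ := norm_nonneg _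
  nlinarith

/-- **The printed identity of (1.65)**, *"|(\overline{U′U₀})ʲ − Ū₀ʲ| = |Ũ′ʲ − 1|"*, bondwise: for unit-norm values
(`q ∈ U1`, e.g. unitary matrices with the operator norm) `‖p − q‖ = ‖pq⁻¹ − 1‖`.
[cite: Balaban1985RegularSpaces, (1.65) p.87] -/
theorem norm_sub_eq_norm_pert {p q : 𝔸ˣ} (hq : q ∈ U1 𝔸) :
    ‖(p : 𝔸) - q‖ = ‖((p * q⁻¹ : 𝔸ˣ) : 𝔸) - 1‖ :=
  le_antisymm (norm_sub_le_norm_pert hq) (norm_pert_le_norm_sub hq)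

/-- The same for configurations: `‖U_b − V₀,b‖ = ‖(pert U V₀)_b − 1‖`, `pert U V₀ = U·V₀⁻¹` bondwise
(`B8Lemma1NonAbelian.pert`, the perturbation of (1.20)/(1.21)). [cite: Balaban1985RegularSpaces, (1.20) p.79] -/
theorem norm_sub_eq_norm_pert_cfg {U V₀ : Site d → Fin d → 𝔸ˣ} (hV₀ : ∀ x κ, V₀ x κ ∈ U1 𝔸) (x : Site d)
    (κ : Fin d) : ‖((U x κ : 𝔸ˣ) : 𝔸) - V₀ x κ‖ = ‖((pert U V₀ x κ : 𝔸ˣ) : 𝔸) - 1‖ :=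
  norm_sub_eq_norm_pert (hV₀ x κ)

end Norms

/-! ## §2 THE DESCENT WITH A BACKGROUND TOWER (p. 87, "Let us take j = k − 1 and let us apply Lemma 1 to
V₀ = Ū₀^{k−1} … We apply again the Lemma 1 to V₀ = Ū₀^{k−2} … Continuing these arguments") -/

section Descent

variable {𝔸 : Type*} [NormedRing 𝔸] [NormOneClass 𝔸] [NormedAlgebra ℂ 𝔸] [CompleteSpace 𝔸]

omit [NormedAlgebra ℂ 𝔸] [CompleteSpace 𝔸] in
/-- `Σ_{κ<ν}|r_κ| ≤ dL` for `r ∈ [0, L)^d` — the interior count (as in `B8Ineq130.step_interior`). [folklore] -/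
private theorem l1_lowPart_boxVec_le_dL {L : ℕ} (ν : Fin d) (r : Fin d → Fin L) :
    (l1 (lowPart ν (boxVec L r)) : ℝ) ≤ (d : ℝ) * L := by
  have h1 : l1 (lowPart ν (boxVec L r)) ≤ d * L := by
    rw [l1_lowPart_eq]
    calc ∑ κ, (if κ < ν then ((boxVec L r κ).natAbs) else 0) ≤ ∑ _κ : Fin d, L :=
          Finset.sum_le_sum fun κ _ => by
            have := (r κ).isLt
            split_ifs
            · simp only [boxVec, Int.natAbs_natCast]; omega
            · omega
      _ = d * L := by simp
  exact_mod_cast h1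

/-- **THE DESCENT WITH A GENERAL BACKGROUND** — the mechanism of (1.65), p. 87: *"Let us take j = k − 1 and let us
apply Lemma 1 to V₀ = Ū₀^{k−1}, V′V₀ = (\overline{U′U₀})^{k−1} = Ũ′^{k−1}Ū₀^{k−1}. Of course all the assumptions
are satisfied and we obtain |V′ − 1| = |Ũ′^{k−1} − 1| < 8d²α₀ + α₁. We apply again the Lemma 1 to V₀ = Ū₀^{k−2},
V′V₀ = Ũ′^{k−2}Ū₀^{k−2} and the constant α₁ replaced by 8d²α₀ + α₁ … Continuing these arguments we get |Ũ′ʲ − 1| <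
8d²α₀L^{−2(k−j−1)} + … + 8d²α₀ + α₁"*, abstract over the tower of cubes `□̃^{(j)} = [tlo n, thi n]`, `n = k − j`
(`B8Ineq130.tlo/thi`): a fine field `U` (= `U′U₀`) with levels `Ūʲ = avgIter L U j`, and a BACKGROUND TOWER `Bg n`
on the depth-`n` lattice (for (1.65): `Bg n = Ū₀^{k−n}`), all `{|u| ≤ 1, |u⁻¹| ≤ 1}`-valued; HYPOTHESES — the fine
level of depth `n ≥ 1` has plaquette variables within `a_n` of `1` on its cube ((1.34) + Prop. 2 of [3]); the
background of depth `n + 1` has plaquette variables within `a_{n+1}` of `1` on every two-block region `B(c₋) ∪ B(c₊)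
= [Lz, Lz + pairTop L κ]` over the depth-`n` cube (exactly what Lemma 1 uses of (1.7) for `V₀`; (1.33) + Prop. 2);
the background tower is consistent under the average (42), `\overline{Bg (n+1)}_c = (Bg n)_c` ((43): `Ū₀^{j+1} =
\overline{Ū₀ʲ}`); the axial gauge (1.19) of `Ū^{k−(n+1)}` RELATIVE TO `Bg (n+1)` in the blocks over the depth-`n`
cube, in the transporter form `Ū(Γ_{Lz,x}) = Bg(Γ_{Lz,x})`, `x ∈ B(Lz)` ((1.24) via `covProd_eq_one_iff`); and the
top closeness `|Ūᵏ_b − (Bg 0)_b| ≤ α₁` on the top cube ((1.35) at `j = k`); smallness `a_nL² ≤ 1/(6(d+1))`,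
`α₁ + Σ_{m<k} 4d²L²a_{m+1} ≤ 1/6` (Lemma 1's "for α₀, α₁ small").  CONCLUSION — for every depth `n ≤ k` and every
bond `⟨x, x + e_ν⟩` of the depth-`n` cube: `|Ū^{k−n}(x, x+e_ν) − (Bg n)(x, x+e_ν)| ≤ α₁ + Σ_{m<n} 4d²L²a_{m+1}`.
One step = Lemma 1 with `V₀ = Bg (n+1)` on a pair of adjacent blocks (`B8Lemma1NonAbelian.lemma1_printedBound`,
`α₀ = a_{n+1}L²`) for a bond crossing between blocks, or its interior half (`B8Lemma1NonAbelian.interior_bound`,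
`2dL·a ≤ 4d²L²a`) for a bond inside one block; `B8Ineq130.descent` is the case `Bg = 1`.
[cite: Balaban1985RegularSpaces, (1.65) p.87, Lemma 1 (1.24)–(1.25) p.79] -/
theorem descent_bg {L : ℕ} (hL : 1 ≤ L) (hd : 1 ≤ d) (lo hi : Site d) (U : Site d → Fin d → 𝔸ˣ)
    (Bg : ℕ → Site d → Fin d → 𝔸ˣ) (k : ℕ) (a : ℕ → ℝ) (α₁ : ℝ)
    (hmem : ∀ j ≤ k, ∀ x μ, avgIter L U j x μ ∈ U1 𝔸)
    (hmemBg : ∀ n ≤ k, ∀ x μ, Bg n x μ ∈ U1 𝔸)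
    (hplaq : ∀ n, 1 ≤ n → n ≤ k →
      B8Lemma1NonAbelian.PlaqSmall (avgIter L U (k - n)) (tlo L lo n) (thi L hi n) (a n))
    (hplaqBg : ∀ n, n < k → ∀ z, tlo L lo n ≤ z → z ≤ thi L hi n → ∀ κ : Fin d,
      B8Lemma1NonAbelian.PlaqSmall (Bg (n + 1)) ((L : ℤ) • z) ((L : ℤ) • z + pairTop L κ) (a (n + 1)))
    (h19 : ∀ n, n < k → ∀ z, tlo L lo n ≤ z → z ≤ thi L hi n → ∀ r : Fin d → Fin L,
      axialFn (avgIter L U (k - (n + 1))) ((L : ℤ) • z) ((L : ℤ) • z + boxVec L r) =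
        axialFn (Bg (n + 1)) ((L : ℤ) • z) ((L : ℤ) • z + boxVec L r))
    (hcons : ∀ n, n < k → ∀ z (κ : Fin d), tlo L lo n ≤ z → z + e κ ≤ thi L hi n →
      bavg L (Bg (n + 1)) ((L : ℤ) • z) κ = Bg n z κ)
    (htop : ∀ x ν, lo ≤ x → x + e ν ≤ hi → ‖((avgIter L U k x ν : 𝔸ˣ) : 𝔸) - Bg 0 x ν‖ ≤ α₁)
    (hα₁ : 0 ≤ α₁)
    (ha : ∀ n, 1 ≤ n → n ≤ k → 0 < a n ∧ a n * (L : ℝ) ^ 2 ≤ 1 / (6 * ((d : ℝ) + 1)))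
    (htot : α₁ + ∑ m ∈ Finset.range k, 4 * (d : ℝ) ^ 2 * (L : ℝ) ^ 2 * a (m + 1) ≤ 1 / 6) :
    ∀ n ≤ k, ∀ (x : Site d) (ν : Fin d), tlo L lo n ≤ x → x + e ν ≤ thi L hi n →
      ‖((avgIter L U (k - n) x ν : 𝔸ˣ) : 𝔸) - Bg n x ν‖ ≤
        α₁ + ∑ m ∈ Finset.range n, 4 * (d : ℝ) ^ 2 * (L : ℝ) ^ 2 * a (m + 1) := by
  have hterm : ∀ m, m + 1 ≤ k → 0 ≤ 4 * (d : ℝ) ^ 2 * (L : ℝ) ^ 2 * a (m + 1) := fun m hm => by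
    have := (ha (m + 1) (by omega) hm).1; positivity
  have hsum_nonneg : ∀ n ≤ k, 0 ≤ ∑ m ∈ Finset.range n, 4 * (d : ℝ) ^ 2 * (L : ℝ) ^ 2 * a (m + 1) :=
    fun n hn => Finset.sum_nonneg fun m hm => hterm m (by have := Finset.mem_range.mp hm; omega)
  have hsum_le : ∀ n ≤ k, ∑ m ∈ Finset.range n, 4 * (d : ℝ) ^ 2 * (L : ℝ) ^ 2 * a (m + 1) ≤
      ∑ m ∈ Finset.range k, 4 * (d : ℝ) ^ 2 * (L : ℝ) ^ 2 * a (m + 1) := fun n hn =>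
    Finset.sum_le_sum_of_subset_of_nonneg (Finset.range_mono hn)
      fun m hm _ => hterm m (by have := Finset.mem_range.mp hm; omega)
  intro n
  induction n with
  | zero =>
    intro _ x ν hx hxν
    simpa using htop x ν hx hxν
  | succ n ih =>
    intro hn x ν hx hxν
    have hn' : n ≤ k := by omega
    have hj : k - n = k - (n + 1) + 1 := by omega
    have hxhi : x ≤ thi L hi (n + 1) := le_of_add_e_le hxν
    have hxν' : tlo L lo (n + 1) ≤ x + e ν := hx.trans (le_add_of_nonneg_right (e_nonneg ν))
    obtain ⟨hz, hz'⟩ := fl_mem hL hx hxhi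
    obtain ⟨hw, hw'⟩ := fl_mem hL hxν' hxν
    have hbx := inBlock_fl hL x
    have hbx' := inBlock_fl hL (x + e ν)
    obtain ⟨r, hr⟩ := (inBlock_iff L _ x).mp hbx
    obtain ⟨r', hr'⟩ := (inBlock_iff L _ (x + e ν)).mp hbx'
    have hW := hmem (k - (n + 1)) (by omega)
    have hV := hmemBg (n + 1) hn
    have hP := hplaq (n + 1) (by omega) hn
    obtain ⟨ha0, ha1⟩ := ha (n + 1) (by omega) hn
    have hB0 : 0 ≤ α₁ + ∑ m ∈ Finset.range n, 4 * (d : ℝ) ^ 2 * (L : ℝ) ^ 2 * a (m + 1) := by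
      have := hsum_nonneg n hn'; linarith
    have hB1 : α₁ + ∑ m ∈ Finset.range n, 4 * (d : ℝ) ^ 2 * (L : ℝ) ^ 2 * a (m + 1) ≤ 1 / 6 := by
      have := hsum_le n hn'; linarith
    have hax := h19 n (by omega) (fl L x) hz hz'
    have hyx : (L : ℤ) • fl L x ≤ x := smul_fl_le hL x
    have hsub : x - (L : ℤ) • fl L x = boxVec L r := sub_eq_iff_eq_add'.mpr hr
    have hAx : axialFn (avgIter L U (k - (n + 1))) ((L : ℤ) • fl L x) x =
        axialFn (Bg (n + 1)) ((L : ℤ) • fl L x) x := by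
      have h := hax r; rwa [← hr] at h
    -- the difference is controlled by the perturbation `Ū·Bg⁻¹` (unit-norm values)
    have hconv : ‖((avgIter L U (k - (n + 1)) x ν : 𝔸ˣ) : 𝔸) - Bg (n + 1) x ν‖ ≤
        ‖((pert (avgIter L U (k - (n + 1))) (Bg (n + 1)) x ν : 𝔸ˣ) : 𝔸) - 1‖ :=
      norm_sub_le_norm_pert (hV x ν)
    rw [Finset.sum_range_succ, ← add_assoc]
    rcases fl_add_e hL x ν with hsame | hcross
    · -- both endpoints of the bond lie in the block `B(L·z)`, `z = fl L x`: the interior half of Lemma 1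
      rw [hsame] at hr'
      have hPU : B8Lemma1NonAbelian.PlaqSmall (avgIter L U (k - (n + 1))) ((L : ℤ) • fl L x) (x + e ν)
          (a (n + 1)) := hP.mono (smul_mem hL hz hz').1 hxν
      have hPB : B8Lemma1NonAbelian.PlaqSmall (Bg (n + 1)) ((L : ℤ) • fl L x) (x + e ν) (a (n + 1)) :=
        (hplaqBg n (by omega) (fl L x) hz hz' ν).mono le_rfl
          (by rw [hr']; exact add_le_add le_rfl (boxVec_le_pairTop L ν r'))
      have hAx' : axialFn (avgIter L U (k - (n + 1))) ((L : ℤ) • fl L x) (x + e ν) =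
          axialFn (Bg (n + 1)) ((L : ℤ) • fl L x) (x + e ν) := by
        have h := hax r'; rwa [← hr'] at h
      have hb := interior_bound (avgIter L U (k - (n + 1))) (Bg (n + 1)) hW hV hPU hPB ((L : ℤ) • fl L x)
        x ν le_rfl hyx le_rfl hAx hAx'
      rw [hsub] at hb
      have hl := l1_lowPart_boxVec_le_dL (d := d) ν r
      have hdL : 2 * ((d : ℝ) * L) * a (n + 1) ≤ 4 * (d : ℝ) ^ 2 * (L : ℝ) ^ 2 * a (n + 1) := by
        have hd1 : (1 : ℝ) ≤ d := by exact_mod_cast hd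
        have hL1 : (1 : ℝ) ≤ L := by exact_mod_cast hL
        have hdL1 : (1 : ℝ) ≤ (d : ℝ) * L := by nlinarith
        have h2 : 2 * ((d : ℝ) * L) ≤ 4 * (d : ℝ) ^ 2 * (L : ℝ) ^ 2 := by nlinarith
        exact mul_le_mul_of_nonneg_right h2 ha0.le
      have hb' : ‖((pert (avgIter L U (k - (n + 1))) (Bg (n + 1)) x ν : 𝔸ˣ) : 𝔸) - 1‖ ≤
          2 * ((d : ℝ) * L) * a (n + 1) := by
        refine hb.trans ?_
        nlinarith
      linarith
    · -- the bond crosses from `B(L·z)` to `B(L·(z + e_ν))`: Lemma 1 (background `Bg (n+1)`) on the pair of blocks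
      rw [hcross] at hr' hw hw' hbx'
      have havg : ‖((bavg L (avgIter L U (k - (n + 1))) ((L : ℤ) • fl L x) ν : 𝔸ˣ) : 𝔸) -
          bavg L (Bg (n + 1)) ((L : ℤ) • fl L x) ν‖ ≤
          α₁ + ∑ m ∈ Finset.range n, 4 * (d : ℝ) ^ 2 * (L : ℝ) ^ 2 * a (m + 1) := by
        have h := ih hn' (fl L x) ν hz hw'
        rw [hj, avgIter_succ, rescale_apply] at h
        rwa [hcons n (by omega) (fl L x) ν hz hw']
      have hpm := pair_mem (lo := lo) (hi := hi) hz hw'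
      rw [smul_add] at hbx'
      have hLne : (L : ℝ) ≠ 0 := by
        have : (L : ℝ) ≥ 1 := by exact_mod_cast hL
        positivity
      have hdiv : a (n + 1) * (L : ℝ) ^ 2 / (L : ℝ) ^ 2 = a (n + 1) :=
        mul_div_cancel_right₀ (a (n + 1)) (pow_ne_zero 2 hLne)
      have H : B8Lemma1NonAbelian.Hyp L (avgIter L U (k - (n + 1))) (Bg (n + 1)) ((L : ℤ) • fl L x) ν
          (a (n + 1) * (L : ℝ) ^ 2 / (L : ℝ) ^ 2)
          (α₁ + ∑ m ∈ Finset.range n, 4 * (d : ℝ) ^ 2 * (L : ℝ) ^ 2 * a (m + 1)) := by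
        refine ⟨hW, hV, ?_, ?_, hax, ?_, havg⟩
        · rw [hdiv]; exact hP.mono hpm.1 hpm.2
        · rw [hdiv]; exact hplaqBg n (by omega) (fl L x) hz hz' ν
        · intro r''; rw [← smul_add]; exact h19 n (by omega) _ hw hw' r''
      have hb := lemma1_printedBound hL H (by positivity) ha1 hB0 hB1 x ν (Or.inl hbx) (Or.inr hbx')
      have h4 : 4 * (d : ℝ) ^ 2 * (a (n + 1) * (L : ℝ) ^ 2) = 4 * (d : ℝ) ^ 2 * (L : ℝ) ^ 2 * a (n + 1) := by
        ring
      linarith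

/-- **The descent, perturbation form** (print: *"|Ũ′ʲ − 1| < …"*, `Ũ′ = Ū·(Bg)⁻¹` bondwise = `pert`): under the
hypotheses of `descent_bg`, `|(Ū^{k−n}·(Bg n)⁻¹)(b) − 1| ≤ α₁ + Σ_{m<n} 4d²L²a_{m+1}` on the depth-`n` cube.
[cite: Balaban1985RegularSpaces, (1.65) p.87, (1.20) p.79] -/
theorem descent_bg_pert {L : ℕ} (hL : 1 ≤ L) (hd : 1 ≤ d) (lo hi : Site d) (U : Site d → Fin d → 𝔸ˣ)
    (Bg : ℕ → Site d → Fin d → 𝔸ˣ) (k : ℕ) (a : ℕ → ℝ) (α₁ : ℝ)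
    (hmem : ∀ j ≤ k, ∀ x μ, avgIter L U j x μ ∈ U1 𝔸)
    (hmemBg : ∀ n ≤ k, ∀ x μ, Bg n x μ ∈ U1 𝔸)
    (hplaq : ∀ n, 1 ≤ n → n ≤ k →
      B8Lemma1NonAbelian.PlaqSmall (avgIter L U (k - n)) (tlo L lo n) (thi L hi n) (a n))
    (hplaqBg : ∀ n, n < k → ∀ z, tlo L lo n ≤ z → z ≤ thi L hi n → ∀ κ : Fin d,
      B8Lemma1NonAbelian.PlaqSmall (Bg (n + 1)) ((L : ℤ) • z) ((L : ℤ) • z + pairTop L κ) (a (n + 1)))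
    (h19 : ∀ n, n < k → ∀ z, tlo L lo n ≤ z → z ≤ thi L hi n → ∀ r : Fin d → Fin L,
      axialFn (avgIter L U (k - (n + 1))) ((L : ℤ) • z) ((L : ℤ) • z + boxVec L r) =
        axialFn (Bg (n + 1)) ((L : ℤ) • z) ((L : ℤ) • z + boxVec L r))
    (hcons : ∀ n, n < k → ∀ z (κ : Fin d), tlo L lo n ≤ z → z + e κ ≤ thi L hi n →
      bavg L (Bg (n + 1)) ((L : ℤ) • z) κ = Bg n z κ)
    (htop : ∀ x ν, lo ≤ x → x + e ν ≤ hi → ‖((avgIter L U k x ν : 𝔸ˣ) : 𝔸) - Bg 0 x ν‖ ≤ α₁)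
    (hα₁ : 0 ≤ α₁)
    (ha : ∀ n, 1 ≤ n → n ≤ k → 0 < a n ∧ a n * (L : ℝ) ^ 2 ≤ 1 / (6 * ((d : ℝ) + 1)))
    (htot : α₁ + ∑ m ∈ Finset.range k, 4 * (d : ℝ) ^ 2 * (L : ℝ) ^ 2 * a (m + 1) ≤ 1 / 6)
    (n : ℕ) (hn : n ≤ k) (x : Site d) (ν : Fin d) (hx : tlo L lo n ≤ x) (hxν : x + e ν ≤ thi L hi n) :
    ‖((pert (avgIter L U (k - n)) (Bg n) x ν : 𝔸ˣ) : 𝔸) - 1‖ ≤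
      α₁ + ∑ m ∈ Finset.range n, 4 * (d : ℝ) ^ 2 * (L : ℝ) ^ 2 * a (m + 1) := by
  rw [← norm_sub_eq_norm_pert_cfg (hmemBg n hn) x ν]
  exact descent_bg hL hd lo hi U Bg k a α₁ hmem hmemBg hplaq hplaqBg h19 hcons htop hα₁ ha htot n hn x ν hx hxν

end Descent

/-! ## §3 (1.65) AS PRINTED, global `ℤ^d` carrier: (1.33), (1.34), (1.35) ⟹ `|(\overline{U′U₀})ʲ − Ū₀ʲ| =
|Ũ′ʲ − 1| < 8d²α₀(L^{−2(k−j−1)} + … + 1) + α₁ < 11d²α₀ + α₁` -/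

section Printed

variable {𝔸 : Type*} [NormedRing 𝔸] [NormOneClass 𝔸] [NormedAlgebra ℂ 𝔸] [CompleteSpace 𝔸]

/-- The descent sum with the p. 87 scales `a_n = 2α₀(Lʲη)² = 2α₀L^{−2n}` (`= B8Ineq130.aLev (α₀/L²) L n`) is the
printed `8d²α₀(L^{−2(n−1)} + … + L⁻² + 1)`. [cite: Balaban1985RegularSpaces, (1.65) p.87] -/
theorem descent_sum_eq_printed {L : ℕ} (hL : 1 ≤ L) (d : ℕ) (α₀ : ℝ) (n : ℕ) :
    ∑ m ∈ Finset.range n, 4 * (d : ℝ) ^ 2 * (L : ℝ) ^ 2 * aLev (α₀ / (L : ℝ) ^ 2) L (m + 1) =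
      8 * (d : ℝ) ^ 2 * α₀ * ∑ m ∈ Finset.range n, (((L : ℝ) ^ m)⁻¹) ^ 2 := by
  have hLne : (L : ℝ) ≠ 0 := by
    have : (L : ℝ) ≥ 1 := by exact_mod_cast hL
    positivity
  have hdiv : α₀ / (L : ℝ) ^ 2 * (L : ℝ) ^ 2 = α₀ := div_mul_cancel₀ _ (pow_ne_zero 2 hLne)
  rw [descent_sum_eq hL, show 8 * (d : ℝ) ^ 2 * (L : ℝ) ^ 2 * (α₀ / (L : ℝ) ^ 2)
      = 8 * (d : ℝ) ^ 2 * (α₀ / (L : ℝ) ^ 2 * (L : ℝ) ^ 2) by ring, hdiv]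

/-- **The last two members of (1.65)**: `8d²α₀(L^{−2(n−1)} + … + 1) ≤ 8d²α₀ · 1/(1 − L⁻²) ≤ (32/3)d²α₀ < 11d²α₀`
for `L ≥ 2`, `d ≥ 1`, `α₀ > 0` (`B8Ineq130.geom_sum_le`: the finite sum is `≤ 4/3`; the tree's constant lemma
`B8.ineq165` is the same arithmetic for the infinite sum). [cite: Balaban1985RegularSpaces, (1.65) p.87] -/
theorem ineq165_members {L : ℕ} (hL : 2 ≤ L) (hd : 1 ≤ d) {α₀ : ℝ} (hα : 0 < α₀) (n : ℕ) :
    8 * (d : ℝ) ^ 2 * α₀ * ∑ m ∈ Finset.range n, (((L : ℝ) ^ m)⁻¹) ^ 2 ≤ 32 / 3 * (d : ℝ) ^ 2 * α₀ ∧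
      32 / 3 * (d : ℝ) ^ 2 * α₀ < 11 * (d : ℝ) ^ 2 * α₀ := by
  have hS := geom_sum_le hL n
  have hd' : (1 : ℝ) ≤ d := by exact_mod_cast hd
  have hpos : 0 < (d : ℝ) ^ 2 * α₀ := by positivity
  constructor
  · have := mul_le_mul_of_nonneg_left hS (by positivity : (0 : ℝ) ≤ 8 * (d : ℝ) ^ 2 * α₀)
    linarith
  · nlinarith

/-- **(1.65) AS PRINTED, GLOBAL `ℤ^d` CARRIER** (p. 87: *"Thus the conditions (1.33)–(1.35) imply
|(\overline{U′U₀})ʲ − Ū₀ʲ| = |Ũ′ʲ − 1| < 11d²α₀ + α₁ on Ω_j^{(j)}. (1.65)"*), kernel-checked for non-abelian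
`G`-valued fields (`G` any gauge group closed under the average (42), e.g. `U(N)`, `SU(N)`).  HYPOTHESES — `L ≥ 2`,
`d ≥ 1`; (1.33)/(1.34), regularity part, at the top level in η-units (*"the bounds |∂U − 1| < α₀η²"*, `η = L^{−k}`),
global sup form, for BOTH `U₀` and `U = U′U₀`: `pdev U₀, pdev U < α₀L^{−2k}`; `α₀` Prop.-1/2-small (`C₀α₀ ≤ ⅓`,
`2α₀ ≤ c₂′`, constants of `B7Prop2Explicit`; print: "for α₀ small"); (1.34), gauge part `U′U₀ ∈ Ax_k(𝔅_k, U₀)`: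
the axial gauge (1.19) of `Ūʲ` relative to `Ū₀ʲ` between all consecutive levels on the tower of cubes `□̃^{(j)}` =
`[tlo n, thi n]` in the transporter form `Ūʲ(Γ_{Lz,x}) = Ū₀ʲ(Γ_{Lz,x})`, `x ∈ B(Lz)`; (1.35) at the top level:
`|Ūᵏ_b − Ū₀ᵏ_b| ≤ α₁` on the top cube `[lo, hi]`; Lemma 1's smallness `11d²α₀ + α₁ ≤ 1/6`.  CONCLUSION — for every
depth `n = k − j ≤ k` and every bond `⟨x, x + e_ν⟩ ⊂ □̃^{(j)}`: `|Ūʲ(x, x+e_ν) − Ū₀ʲ(x, x+e_ν)| ≤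
8d²α₀(L^{−2(n−1)} + … + L⁻² + 1) + α₁ < 11d²α₀ + α₁` (first `≤` where print has `<`: the inputs are
`≤`-hypotheses).  Proof = the printed one: Prop. 2 of [3] at every level for both fields
(`B8Ineq130.ineq128_global`: `|∂Ūʲ − 1|, |∂Ū₀ʲ − 1| < 2α₀(Lʲη)²`), then `descent_bg` with `Bg n = Ū₀^{k−n}`.
[cite: Balaban1985RegularSpaces, (1.65) p.87, (1.33)–(1.35) p.82, (1.19) p.79] -/
theorem ineq165_global (L : ℕ) (hL : 2 ≤ L) (hd : 1 ≤ d) {G : Subgroup 𝔸ˣ} (hG : AvgClosed d L G) (k : ℕ)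
    (U₀ U : Site d → Fin d → 𝔸ˣ) (hU₀ : ∀ x κ, U₀ x κ ∈ G) (hU : ∀ x κ, U x κ ∈ G)
    {α₀ α₁ : ℝ} (hα : 0 < α₀) (hα3 : C0 d * α₀ ≤ 1 / 3) (hα2 : 2 * α₀ ≤ c2' d L)
    (h33 : pdev U₀ < α₀ * (((L : ℝ) ^ k)⁻¹) ^ 2) (h34 : pdev U < α₀ * (((L : ℝ) ^ k)⁻¹) ^ 2)
    (lo hi : Site d)
    (h19 : ∀ n, n < k → ∀ z, tlo L lo n ≤ z → z ≤ thi L hi n → ∀ r : Fin d → Fin L,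
      axialFn (avgIter L U (k - (n + 1))) ((L : ℤ) • z) ((L : ℤ) • z + boxVec L r) =
        axialFn (avgIter L U₀ (k - (n + 1))) ((L : ℤ) • z) ((L : ℤ) • z + boxVec L r))
    (h35 : ∀ x ν, lo ≤ x → x + e ν ≤ hi →
      ‖((avgIter L U k x ν : 𝔸ˣ) : 𝔸) - avgIter L U₀ k x ν‖ ≤ α₁)
    (hα₁ : 0 ≤ α₁) (hsmall : 11 * (d : ℝ) ^ 2 * α₀ + α₁ ≤ 1 / 6)
    (n : ℕ) (hn : n ≤ k) (x : Site d) (ν : Fin d) (hx : tlo L lo n ≤ x) (hxν : x + e ν ≤ thi L hi n) :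
    ‖((avgIter L U (k - n) x ν : 𝔸ˣ) : 𝔸) - avgIter L U₀ (k - n) x ν‖ ≤
        8 * (d : ℝ) ^ 2 * α₀ * (∑ m ∈ Finset.range n, (((L : ℝ) ^ m)⁻¹) ^ 2) + α₁ ∧
      8 * (d : ℝ) ^ 2 * α₀ * (∑ m ∈ Finset.range n, (((L : ℝ) ^ m)⁻¹) ^ 2) + α₁ <
        11 * (d : ℝ) ^ 2 * α₀ + α₁ := by
  have hL1 : 1 ≤ L := le_trans (by norm_num) hL
  have hL' : (0 : ℝ) < L := by exact_mod_cast lt_of_lt_of_le (by norm_num) hL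
  have hLne : (L : ℝ) ≠ 0 := hL'.ne'
  have hdiv : α₀ / (L : ℝ) ^ 2 * (L : ℝ) ^ 2 = α₀ := div_mul_cancel₀ _ (pow_ne_zero 2 hLne)
  have hβ : 0 < α₀ / (L : ℝ) ^ 2 := by positivity
  have hα3' : C0 d * (α₀ / (L : ℝ) ^ 2 * (L : ℝ) ^ 2) ≤ 1 / 3 := by rw [hdiv]; exact hα3
  have hα2' : 2 * (α₀ / (L : ℝ) ^ 2 * (L : ℝ) ^ 2) ≤ c2' d L := by rw [hdiv]; exact hα2
  have h17 : ∀ V : Site d → Fin d → 𝔸ˣ, pdev V < α₀ * (((L : ℝ) ^ k)⁻¹) ^ 2 →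
      pdev V < α₀ / (L : ℝ) ^ 2 * (L : ℝ) ^ 2 * (((L : ℝ) ^ k)⁻¹) ^ 2 := fun V hV => by rwa [hdiv]
  -- (1.128)-type per-level plaquette bounds for both towers (Prop. 2 of [3])
  have h128 := fun m hm => ineq128_global L hL hG k U hU hβ hα3' hα2' (h17 U h34) m hm
  have h128₀ := fun m hm => ineq128_global L hL hG k U₀ hU₀ hβ hα3' hα2' (h17 U₀ h33) m hm
  have hmemG := (h128 0 (Nat.zero_le k)).2
  have hmemG₀ := (h128₀ 0 (Nat.zero_le k)).2
  have hmem : ∀ j ≤ k, ∀ x μ, avgIter L U j x μ ∈ U1 𝔸 := fun j hj x μ =>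
    hG.le_U1 (hmemG j (by simpa using hj) x μ)
  have hmem₀ : ∀ j ≤ k, ∀ x μ, avgIter L U₀ j x μ ∈ U1 𝔸 := fun j hj x μ =>
    hG.le_U1 (hmemG₀ j (by simpa using hj) x μ)
  -- the smallness bookkeeping
  have hS := geom_sum_le hL k
  have h8 : 0 ≤ 8 * (d : ℝ) ^ 2 * α₀ := by positivity
  have htot : α₁ + ∑ m ∈ Finset.range k, 4 * (d : ℝ) ^ 2 * (L : ℝ) ^ 2 * aLev (α₀ / (L : ℝ) ^ 2) L (m + 1)
      ≤ 1 / 6 := by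
    rw [descent_sum_eq_printed hL1]
    have := mul_le_mul_of_nonneg_left hS h8
    have hd' : (1 : ℝ) ≤ d := by exact_mod_cast hd
    nlinarith
  have ha : ∀ m, 1 ≤ m → m ≤ k → 0 < aLev (α₀ / (L : ℝ) ^ 2) L m ∧
      aLev (α₀ / (L : ℝ) ^ 2) L m * (L : ℝ) ^ 2 ≤ 1 / (6 * ((d : ℝ) + 1)) := fun m hm1 _ =>
    ⟨by unfold aLev; positivity,
      (aLev_mul_sq_le hL1 hβ.le hm1).trans (by rw [hdiv]; exact two_mul_le_of_C0 hα.le hα3)⟩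
  have hdesc := descent_bg hL1 hd lo hi U (fun m => avgIter L U₀ (k - m)) k (aLev (α₀ / (L : ℝ) ^ 2) L) α₁
    hmem (fun m hm x μ => hmem₀ (k - m) (by omega) x μ)
    (fun m _ hmk => plaqSmall_of_pdev (hmem _ (by omega)) (h128 m hmk).1.le _ _)
    (fun m hmk z _ _ κ => plaqSmall_of_pdev (hmem₀ _ (by omega)) (h128₀ (m + 1) (by omega)).1.le _ _)
    h19
    (fun m hmk z κ _ _ => by
      have hj : k - m = k - (m + 1) + 1 := by omega
      show bavg L (avgIter L U₀ (k - (m + 1))) ((L : ℤ) • z) κ = avgIter L U₀ (k - m) z κ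
      rw [hj, avgIter_succ, rescale_apply])
    (fun x ν hx hxν => by simpa using h35 x ν hx hxν) hα₁ ha htot n hn x ν hx hxν
  rw [descent_sum_eq_printed hL1] at hdesc
  obtain ⟨hm1, hm2⟩ := ineq165_members hL hd hα n
  exact ⟨by linarith, by linarith⟩

/-- **(1.65), the `|Ũ′ʲ − 1|` member** (perturbation form, `Ũ′ʲ = Ūʲ(Ū₀ʲ)⁻¹` bondwise = `pert (avgIter L U j)
(avgIter L U₀ j)`; for `U = U′ * U₀` this is `B8Prop6OfThm4.tavg L U₀ U′ j` by `rfl`): under the hypotheses of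
`ineq165_global`, `|Ũ′ʲ(x, x+e_ν) − 1| < 11d²α₀ + α₁` on `□̃^{(j)}`. [cite: Balaban1985RegularSpaces, (1.65) p.87] -/
theorem ineq165_global_pert (L : ℕ) (hL : 2 ≤ L) (hd : 1 ≤ d) {G : Subgroup 𝔸ˣ} (hG : AvgClosed d L G) (k : ℕ)
    (U₀ U : Site d → Fin d → 𝔸ˣ) (hU₀ : ∀ x κ, U₀ x κ ∈ G) (hU : ∀ x κ, U x κ ∈ G)
    {α₀ α₁ : ℝ} (hα : 0 < α₀) (hα3 : C0 d * α₀ ≤ 1 / 3) (hα2 : 2 * α₀ ≤ c2' d L)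
    (h33 : pdev U₀ < α₀ * (((L : ℝ) ^ k)⁻¹) ^ 2) (h34 : pdev U < α₀ * (((L : ℝ) ^ k)⁻¹) ^ 2)
    (lo hi : Site d)
    (h19 : ∀ n, n < k → ∀ z, tlo L lo n ≤ z → z ≤ thi L hi n → ∀ r : Fin d → Fin L,
      axialFn (avgIter L U (k - (n + 1))) ((L : ℤ) • z) ((L : ℤ) • z + boxVec L r) =
        axialFn (avgIter L U₀ (k - (n + 1))) ((L : ℤ) • z) ((L : ℤ) • z + boxVec L r))
    (h35 : ∀ x ν, lo ≤ x → x + e ν ≤ hi →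
      ‖((avgIter L U k x ν : 𝔸ˣ) : 𝔸) - avgIter L U₀ k x ν‖ ≤ α₁)
    (hα₁ : 0 ≤ α₁) (hsmall : 11 * (d : ℝ) ^ 2 * α₀ + α₁ ≤ 1 / 6)
    (n : ℕ) (hn : n ≤ k) (x : Site d) (ν : Fin d) (hx : tlo L lo n ≤ x) (hxν : x + e ν ≤ thi L hi n) :
    ‖((pert (avgIter L U (k - n)) (avgIter L U₀ (k - n)) x ν : 𝔸ˣ) : 𝔸) - 1‖ < 11 * (d : ℝ) ^ 2 * α₀ + α₁ := by
  have hL1 : 1 ≤ L := le_trans (by norm_num) hL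
  have hL' : (0 : ℝ) < L := by exact_mod_cast lt_of_lt_of_le (by norm_num) hL
  have hdiv : α₀ / (L : ℝ) ^ 2 * (L : ℝ) ^ 2 = α₀ := div_mul_cancel₀ _ (pow_ne_zero 2 hL'.ne')
  have hβ : 0 < α₀ / (L : ℝ) ^ 2 := by positivity
  have hα3' : C0 d * (α₀ / (L : ℝ) ^ 2 * (L : ℝ) ^ 2) ≤ 1 / 3 := by rw [hdiv]; exact hα3
  have hα2' : 2 * (α₀ / (L : ℝ) ^ 2 * (L : ℝ) ^ 2) ≤ c2' d L := by rw [hdiv]; exact hα2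
  have h33' : pdev U₀ < α₀ / (L : ℝ) ^ 2 * (L : ℝ) ^ 2 * (((L : ℝ) ^ k)⁻¹) ^ 2 := by rwa [hdiv]
  have hmemG₀ := (ineq128_global L hL hG k U₀ hU₀ hβ hα3' hα2' h33' 0 (Nat.zero_le k)).2
  have hV : ∀ x μ, avgIter L U₀ (k - n) x μ ∈ U1 𝔸 := fun x μ =>
    hG.le_U1 (hmemG₀ (k - n) (by simp) x μ)
  rw [← norm_sub_eq_norm_pert_cfg hV x ν]
  have h := ineq165_global L hL hd hG k U₀ U hU₀ hU hα hα3 hα2 h33 h34 lo hi h19 h35 hα₁ hsmall n hn x ν hx hxν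
  exact h.1.trans_lt h.2

end Printed

end Literature.MathematicalPhysics.QuantumFieldTheory.Balaban1983to89.B8Ineq165Descent
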